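import Mathlib
import HarnessLib
import Literature.MathematicalPhysics.QuantumLattice.ScaleZeroAngularFactorPeriodic
import Literature.MathematicalPhysics.QuantumLattice.ScaleZeroMultiplierFibre
import Literature.MathematicalPhysics.QuantumLattice.HubbardScaleZeroSectorSymbolGeometry
import Summits.HubbardSuperconductivity.HubbardSuperconductivity.Theorems.KLProgrammeKLRegimeEngineScaleZeroE4Bands
import Summits.HubbardSuperconductivity.HubbardSuperconductivity.Theorems.KLProgrammeKLRegimeEngineFramePosKernelBound
import Summits.HubbardSuperconductivity.HubbardSuperconductivity.Theorems.KLProgrammeSectorisedLegKernelsDefs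
import Summits.HubbardSuperconductivity.HubbardSuperconductivity.Theorems.KLProgrammeKLRegimeSplitOnWindow

/-!
# (E4)₀, step M4: the scale-`0` sector multiplier at CENTRED momenta as `radial(ω̃, e_K(c⃗)) · Ã_ω(c⃗)` with a smooth global
# angular factor, and its vanishing near the zone boundary

Helper toward `stmt-HubbardSuperconductivity-20236` (`KLRegimeEngineV16`, stub `stub_engine_scale0`, conjunct (E4)₀
`EngineFirstMoments … 0`), item M4 of k3c2-p1 g3's T_X plan (NOTES-g3 `## Census`): the weighted multiplier torus sum `T_w` of
`firstMoment_zero_le_of_torusSums` is computed by the centred-sampling pipeline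
(`HubbardSymbolCentredComposition.norm_fwdDiff_iter₂_comp_mul_centred_le`: symbols `y ↦ g(ω, u(c⃗(y)))·κ(c⃗(y))` with `g` a plane
function carrying a `FibreEnvBound` — here `g = (bgmCutoff₂ klE0 · : ℂ)`, `ScaleZeroMultiplierFibre` — `u, κ` smooth with GLOBAL
derivative bounds, and the product vanishing near the zone boundary).  This file identifies the scale-`0` multiplier
`klAnisoFamily … klE0 0 ω` with such a product:

* `klAnisoFamily_zero_apply_cutoffFreqFn` — `F_ω(k₀,k⃗) = χ₂-radial(ω̃_{k₀}, e_K(k⃗))·ζ̃_{0,ω}(θ(c⃗(k⃗)))` in `cutoffFreqFn` form; `bgmCutoff₂_fbPt`;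
* `le_nambuXiCT_of_exists_abs_centred_ge` — near the zone boundary (`|c_l| ≥ π − δ₀`) the band is `≥ −δ₀² − μ − κ`;
  `abs_centred_le_of_abs_nambuXiCT_lt` — so the shell `|e_K| < e₀` has `|c_i| ≤ π − δ₀` once `e₀ ≤ −δ₀² − μ − κ`;
* **`klAnisoFamily_zero_eq_centred_mul`** — `F_ω(k₀,k⃗) = (bgmCutoff₂ e₀ (fbPt ω̃ (frameLevel μ K (c⃗))) : ℂ)·(zoneAngularRaw r₁ δ₀ 0 ω (c⃗) : ℂ)`
  for `r₁² ≤ 4 + μ − κ − e₀`, `e₀ ≤ −δ₀² − μ − κ` (`Ã = zoneAngularRaw r₁ δ₀ 0 ω` is smooth on the whole plane with all-order global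
  bounds uniform in `ω`, `ScaleZeroAngularFactorPeriodic.exists_norm_iteratedFDeriv_zoneAngularRaw_le`);
  **`bgmGridSymbol_eq_centred_piece`** — the padded symbol in the window form of `HubbardUVGridPieceMoment.spaceDiff_window` (`c = 1`);
* **`bgmCutoff₂_frameLevel_eq_zero_of_cos_le`**, **`centredPiece_vanish_of_cos_le`** — the `hvan` hypothesis of the centred sampling
  lemmas for the base band `u = frameLevel μ K`, any factor `κ`;
* the regime forms **`klAnisoFamily_zero_eq_centred_mul_of_frameOK`**, **`bgmGridSymbol_eq_centred_piece_of_frameOK`**,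
  **`centredPiece_vanish_of_frameOK`** (`FrameOK`, `μ ∈ klWindowC`, `(16/15)·Gfr0·|U| ≤ 1/50`, `2¹⁵ ≤ L`; `r₁ = 1`, `δ₀ = 1/4`).

Everything is proved; no definitions, no named facts, no sorry. [cite: BenfattoGiulianiMastropietro2006, §2.5 (2.45)–(2.48), (2.36aa)]
-/

noncomputable section

namespace Summit.HubbardSuperconductivity.HubbardSuperconductivity.Theorems.EngineV8

set_option linter.dupNamespace false -- summit = problem name (single-conjunct summit), D-0017

open Real Finset Literature.MathematicalPhysics.QuantumLattice Literature.Probability.LatticeModels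
open Summit.HubbardSuperconductivity.HubbardSuperconductivity.Theorems.KLRegimeSplit
open Summit.HubbardSuperconductivity.HubbardSuperconductivity.Theorems.KLProgrammeLegKernels
open Summit.HubbardSuperconductivity.HubbardSuperconductivity.Theorems.DispersionFlow
open Summit.HubbardSuperconductivity.HubbardSuperconductivity.Theorems.ScaleZeroDecay

variable {L M N : ℕ}

/-! ### §1 The multiplier in radial × angular form -/

/-- The radial profile on the band line: `bgmCutoff₂ e₀ (ω, e) = cutoffFreqFn e₀ e ω`. -/
theorem bgmCutoff₂_fbPt {e₀ : ℝ} (he : e₀ ≠ 0) (ν e : ℝ) : bgmCutoff₂ e₀ (fbPt ν e) = cutoffFreqFn e₀ e ν := by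
  rw [bgmCutoff₂_eq_cutoffFreqFn he, fbPt_apply_one, fbPt_apply_zero]

/-- Off the shell `|e| ≥ e₀` the radial profile vanishes. -/
theorem bgmCutoff₂_fbPt_eq_zero_of_le_abs {e₀ : ℝ} (he : 0 < e₀) (ν : ℝ) {e : ℝ} (h : e₀ ≤ |e|) :
    bgmCutoff₂ e₀ (fbPt ν e) = 0 := by
  rw [bgmCutoff₂_fbPt he.ne', cutoffFreqFn_eq_zero_of_le_abs_band he h]

/-- **The scale-`0` multiplier in closed form**: `F_ω(k₀,k⃗) = cutoffFreqFn e₀ (e_K k⃗) (ω̃_{k₀}) · ζ̃_{0,ω}(θ(k⃗))`. -/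
theorem klAnisoFamily_zero_apply_cutoffFreqFn [NeZero L] (e₀ β μ : ℝ) (K : TrigPolyC4v) (ω : Fin (sectorCount 0)) (k : FreqMomentum L M) :
    klAnisoFamily L M β μ K e₀ 0 ω k =
      (((cutoffFreqFn e₀ (nambuXiCT L μ K k.2) (matsubaraFreq β M k.1) * sectorWeightCirc 0 ω (momentumAngle L k.2) : ℝ)) : ℂ) := by
  simp only [klAnisoFamily]
  rw [bgmMultiplier, cutoffFreqFn, gnSqCutoff, gnScaleCutoff]
  simp

/-- The lattice band at the centred momentum in the `frameLevel` vocabulary: `e_K(k⃗) = frameLevel μ K (c⃗(k⃗))`. -/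
theorem nambuXiCT_eq_frameLevel_centred [NeZero L] (μ : ℝ) (K : TrigPolyC4v) (k : TorusSite 2 L) :
    nambuXiCT L μ K k = frameLevel μ K (WithLp.toLp 2 (torusCentredMomentum L k)) := by
  rw [frameLevel_toLp_eq_ctBandFn, nambuXiCT_eq_ctBandFn, torusCentredMomentum_eq_zoneCentred, zoneCentred_eq_sub_zsmul]
  have h := ctBandFn_periodic μ K (latticeMomentum L k) (fun i => -toIocDiv Real.two_pi_pos (-π) (latticeMomentum L k i))
  rw [← h]
  congr 1
  funext i
  push_cast
  ring

/-! ### §2 The shell avoids the zone boundary (δ₀-form) -/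

/-- **Near the zone boundary the band is large**: if some centred coordinate has `|c_l| ≥ π − δ₀` (`δ₀ ≤ π`) and `|K| ≤ κ`, then
`e_K(k⃗) ≥ −δ₀² − μ − κ` (`cos c_l ≤ −cos δ₀ ≤ −1 + δ₀²/2`). -/
theorem le_nambuXiCT_of_exists_abs_centred_ge [NeZero L] {μ κ δ₀ : ℝ} {K : TrigPolyC4v} (hK : ∀ p, |K.eval p| ≤ κ)
    (hδπ : δ₀ ≤ π) (k : TorusSite 2 L) (h : ∃ l : Fin 2, π - δ₀ ≤ |torusCentredMomentum L k l|) :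
    -δ₀ ^ 2 - μ - κ ≤ nambuXiCT L μ K k := by
  rw [nambuXiCT_eq_centred]
  set c := torusCentredMomentum L k with hc
  have hcπ : ∀ i, |c i| ≤ π := fun i => by
    rw [hc, torusCentredMomentum_eq_zoneCentred]; exact abs_zoneCentred_le _ i
  have hcosδ : 1 - δ₀ ^ 2 / 2 ≤ Real.cos δ₀ := Real.one_sub_sq_div_two_le_cos
  -- the boundary coordinate
  have hbd : ∀ i, π - δ₀ ≤ |c i| → Real.cos (c i) ≤ -(1 - δ₀ ^ 2 / 2) := fun i hi => by
    rw [← Real.cos_abs]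
    have h1 : Real.cos |c i| ≤ Real.cos (π - δ₀) := Real.cos_le_cos_of_nonneg_of_le_pi (by linarith) (hcπ i) hi
    rw [Real.cos_pi_sub] at h1
    linarith
  have hKp := (abs_le.1 (hK (latticeMomentum L k))).2
  rcases Fin.exists_fin_two.1 h with h0 | h1
  · have := hbd 0 h0
    have := Real.cos_le_one (c 1)
    nlinarith
  · have := hbd 1 h1
    have := Real.cos_le_one (c 0)
    nlinarith

/-- **Inside the shell the centred coordinates stay `δ₀` away from `±π`**: `|e_K(k⃗)| < e₀`, `e₀ ≤ −δ₀² − μ − κ` give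
`|c_i(k⃗)| ≤ π − δ₀` for both `i`. -/
theorem abs_centred_le_of_abs_nambuXiCT_lt [NeZero L] {μ κ δ₀ e₀ : ℝ} {K : TrigPolyC4v} (hK : ∀ p, |K.eval p| ≤ κ)
    (hδπ : δ₀ ≤ π) (hδ : e₀ ≤ -δ₀ ^ 2 - μ - κ) (k : TorusSite 2 L) (h : |nambuXiCT L μ K k| < e₀) (i : Fin 2) :
    |torusCentredMomentum L k i| ≤ π - δ₀ := by
  by_contra hlt
  push Not at hlt
  have h1 := le_nambuXiCT_of_exists_abs_centred_ge (μ := μ) hK hδπ k ⟨i, hlt.le⟩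
  have h2 : nambuXiCT L μ K k < e₀ := (le_abs_self _).trans_lt h
  linarith

/-! ### §3 The identification -/

/-- **The scale-`0` multiplier as radial profile × smooth global angular factor at the centred momentum**: for `r₁² ≤ 4 + μ − κ − e₀`
and `e₀ ≤ −δ₀² − μ − κ` (`|K| ≤ κ`, `0 < r₁`, `0 < δ₀ ≤ π`),
`F_ω(k₀,k⃗) = (bgmCutoff₂ e₀ (ω̃_{k₀}, frameLevel μ K (c⃗(k⃗))) : ℂ) · (zoneAngularRaw r₁ δ₀ 0 ω (c⃗(k⃗)) : ℂ)`. -/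
theorem klAnisoFamily_zero_eq_centred_mul [NeZero L] {e₀ μ κ r₁ δ₀ : ℝ} (he : 0 < e₀) {K : TrigPolyC4v} (hK : ∀ p, |K.eval p| ≤ κ)
    (hr₁ : 0 < r₁) (hδ₀ : 0 < δ₀) (hδπ : δ₀ ≤ π) (hr : r₁ ^ 2 ≤ 4 + μ - κ - e₀) (hδ : e₀ ≤ -δ₀ ^ 2 - μ - κ) (β : ℝ)
    (ω : Fin (sectorCount 0)) (k : FreqMomentum L M) :
    klAnisoFamily L M β μ K e₀ 0 ω k =
      ((bgmCutoff₂ e₀ (fbPt (matsubaraFreq β M k.1) (frameLevel μ K (WithLp.toLp 2 (torusCentredMomentum L k.2)))) : ℝ) : ℂ) *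
        ((zoneAngularRaw r₁ δ₀ 0 ((ω : ℕ) : ℤ) (WithLp.toLp 2 (torusCentredMomentum L k.2)) : ℝ) : ℂ) := by
  rw [klAnisoFamily_zero_apply_cutoffFreqFn, ← nambuXiCT_eq_frameLevel_centred, bgmCutoff₂_fbPt he.ne']
  by_cases hs : |nambuXiCT L μ K k.2| < e₀
  · -- on the shell the plateau is `1`
    have hR : r₁ ≤ ‖(WithLp.toLp 2 (torusCentredMomentum L k.2) : EuclideanSpace ℝ (Fin 2))‖ := by
      rw [← norm_momToComplex_ofLp, WithLp.ofLp_toLp]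
      exact le_norm_centred_of_abs_nambuXiCT_lt hK hr k.2 hs
    have hb : ∀ i, |(WithLp.toLp 2 (torusCentredMomentum L k.2) : EuclideanSpace ℝ (Fin 2)) i| ≤ π - δ₀ := fun i => by
      rw [PiLp.toLp_apply]; exact abs_centred_le_of_abs_nambuXiCT_lt hK hδπ hδ k.2 hs i
    rw [zoneAngularRaw, WithLp.ofLp_toLp, zonePlateau_eq_one hr₁ hδ₀ hR hb, mul_one, Complex.ofReal_mul]
    rfl
  · -- off the shell the radial factor is `0`
    push Not at hs
    rw [cutoffFreqFn_eq_zero_of_le_abs_band he hs]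
    simp

/-- **The padded symbol in piece form** (`HubbardUVGridPieceMoment.spaceDiff_window` with `c = 1`):
`G_ω(q₀,q⃗) = [val q₀ < 2M]·1²·(bgmCutoff₂ e₀ (ω̃_{q₀}, frameLevel μ K (c⃗(q⃗))) : ℂ)·(Ã_ω(c⃗(q⃗)) : ℂ)`. -/
theorem bgmGridSymbol_eq_centred_piece [NeZero L] {e₀ μ κ r₁ δ₀ : ℝ} (he : 0 < e₀) {K : TrigPolyC4v} (hK : ∀ p, |K.eval p| ≤ κ)
    (hr₁ : 0 < r₁) (hδ₀ : 0 < δ₀) (hδπ : δ₀ ≤ π) (hr : r₁ ^ 2 ≤ 4 + μ - κ - e₀) (hδ : e₀ ≤ -δ₀ ^ 2 - μ - κ) (β : ℝ)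
    (ω : Fin (sectorCount 0)) (q₀ : TorusSite 1 N) (qv : TorusSite 2 L) :
    bgmGridSymbol L M N e₀ β μ K ω q₀ qv = if (q₀ 0).val < 2 * M then (((1 : ℝ) : ℂ)) ^ 2 *
      (((bgmCutoff₂ e₀ (fbPt (gridFreq M N β q₀) (frameLevel μ K (WithLp.toLp 2 (torusCentredMomentum L qv)))) : ℝ) : ℂ) *
        ((zoneAngularRaw r₁ δ₀ 0 ((ω : ℕ) : ℤ) (WithLp.toLp 2 (torusCentredMomentum L qv)) : ℝ) : ℂ)) else 0 := by
  unfold bgmGridSymbol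
  split_ifs with h
  · rw [show bgmMultiplier L M e₀ β (nambuXiCT L μ K) 0 ω = klAnisoFamily L M β μ K e₀ 0 ω from rfl,
      klAnisoFamily_zero_eq_centred_mul he hK hr₁ hδ₀ hδπ hr hδ β ω, matsubaraFreq_eq_gridFreq β q₀ h]
    simp
  · rfl

/-! ### §4 Vanishing near the zone boundary (the `hvan` hypothesis of the centred sampling lemmas) -/

/-- **The radial factor of the base band vanishes near the zone boundary**: if `cos p_l ≤ −c₀` for some `l` and
`e₀ ≤ 2c₀ − 2 − μ − κ` (`|K| ≤ κ`), then `bgmCutoff₂ e₀ (ω, frameLevel μ K p) = 0`. -/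
theorem bgmCutoff₂_frameLevel_eq_zero_of_cos_le {e₀ μ κ c₀ : ℝ} (he : 0 < e₀) {K : TrigPolyC4v} (hK : ∀ p, |K.eval p| ≤ κ)
    (hc : e₀ ≤ 2 * c₀ - 2 - μ - κ) (p : Fin 2 → ℝ) (hp : ∃ l : Fin 2, Real.cos (p l) ≤ -c₀) (ν : ℝ) :
    bgmCutoff₂ e₀ (fbPt ν (frameLevel μ K (WithLp.toLp 2 p))) = 0 := by
  refine bgmCutoff₂_fbPt_eq_zero_of_le_abs he ν ((?_ : e₀ ≤ _).trans (le_abs_self _))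
  rw [frameLevel_toLp_eq_ctBandFn, ctBandFn]
  have hKp := (abs_le.1 (hK p)).2
  rcases Fin.exists_fin_two.1 hp with h0 | h1
  · have := Real.cos_le_one (p 1); linarith
  · have := Real.cos_le_one (p 0); linarith

/-- **`hvan` for the base piece**: with any real factor `κf`, the product `(bgmCutoff₂ e₀ (ω, frameLevel μ K p) : ℂ)·(κf p : ℂ)`
vanishes at every `p` with `cos p_l ≤ −cos(4π/L)` for some `l`, once `e₀ ≤ 2cos(4π/L) − 2 − μ − κ`. -/
theorem centredPiece_vanish_of_cos_le {e₀ μ κ : ℝ} (he : 0 < e₀) {K : TrigPolyC4v} (hK : ∀ p, |K.eval p| ≤ κ)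
    (hc : e₀ ≤ 2 * Real.cos (4 * π / L) - 2 - μ - κ) (κf : EuclideanSpace ℝ (Fin 2) → ℝ) (ν : ℝ) :
    ∀ p : Fin 2 → ℝ, (∃ l : Fin 2, Real.cos (p l) ≤ -Real.cos (4 * π / L)) →
      ((bgmCutoff₂ e₀ (fbPt ν (frameLevel μ K (WithLp.toLp 2 p))) : ℝ) : ℂ) * (((κf (WithLp.toLp 2 p)) : ℝ) : ℂ) = 0 := by
  intro p hp
  rw [bgmCutoff₂_frameLevel_eq_zero_of_cos_le he hK hc p hp ν]
  simp

/-! ### §5 The regime forms (`e₀ = klE0`, `r₁ = 1`, `δ₀ = 1/4`) -/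

section Regime

variable {R : RenConsts} {U μ : ℝ} {Nsc : ℕ} {K : TrigPolyC4v}

/-- In the regime `μ ∈ klWindowC`, `(16/15)Gfr0|U| ≤ 1/50`: `1² ≤ 4 + μ − κ − klE0` and `klE0 ≤ −(1/4)² − μ − κ` for
`κ = (16/15)Gfr0|U|`. -/
theorem scaleZero_shell_params (hμ : μ ∈ klWindowC) (hκU : 16 / 15 * (R.Gfr 0 * |U|) ≤ 1 / 50) :
    (1 : ℝ) ^ 2 ≤ 4 + μ - 16 / 15 * (R.Gfr 0 * |U|) - klE0 ∧ klE0 ≤ -(1 / 4 : ℝ) ^ 2 - μ - 16 / 15 * (R.Gfr 0 * |U|) := by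
  obtain ⟨hμ1, hμ2⟩ := hμ
  rw [klE0]
  constructor <;> nlinarith

/-- **M4, regime form**: under `FrameOK R U Nsc μ K`, `μ ∈ klWindowC`, `(16/15)Gfr0|U| ≤ 1/50`, for all `β, ω, k`,
`klAnisoFamily … klE0 0 ω k = (bgmCutoff₂ klE0 (ω̃, frameLevel μ K (c⃗)) : ℂ)·(zoneAngularRaw 1 (1/4) 0 ω (c⃗) : ℂ)`. -/
theorem klAnisoFamily_zero_eq_centred_mul_of_frameOK [NeZero L] (hK : FrameOK R U Nsc μ K) (hR : ∀ j, 0 ≤ R.Gfr j)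
    (hμ : μ ∈ klWindowC) (hκU : 16 / 15 * (R.Gfr 0 * |U|) ≤ 1 / 50) (β : ℝ) (ω : Fin (sectorCount 0)) (k : FreqMomentum L M) :
    klAnisoFamily L M β μ K klE0 0 ω k =
      ((bgmCutoff₂ klE0 (fbPt (matsubaraFreq β M k.1) (frameLevel μ K (WithLp.toLp 2 (torusCentredMomentum L k.2)))) : ℝ) : ℂ) *
        ((zoneAngularRaw 1 (1 / 4) 0 ((ω : ℕ) : ℤ) (WithLp.toLp 2 (torusCentredMomentum L k.2)) : ℝ) : ℂ) := by
  obtain ⟨hr, hδ⟩ := scaleZero_shell_params (R := R) hμ hκU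
  exact klAnisoFamily_zero_eq_centred_mul (by norm_num [klE0] : (0 : ℝ) < klE0) (abs_eval_le_of_frameOK hK hR) one_pos (by norm_num)
    (by linarith [Real.pi_gt_three]) hr hδ β ω k

/-- **The padded symbol, regime form.** -/
theorem bgmGridSymbol_eq_centred_piece_of_frameOK [NeZero L] (hK : FrameOK R U Nsc μ K) (hR : ∀ j, 0 ≤ R.Gfr j)
    (hμ : μ ∈ klWindowC) (hκU : 16 / 15 * (R.Gfr 0 * |U|) ≤ 1 / 50) (β : ℝ) (ω : Fin (sectorCount 0)) (q₀ : TorusSite 1 N)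
    (qv : TorusSite 2 L) :
    bgmGridSymbol L M N klE0 β μ K ω q₀ qv = if (q₀ 0).val < 2 * M then (((1 : ℝ) : ℂ)) ^ 2 *
      (((bgmCutoff₂ klE0 (fbPt (gridFreq M N β q₀) (frameLevel μ K (WithLp.toLp 2 (torusCentredMomentum L qv)))) : ℝ) : ℂ) *
        ((zoneAngularRaw 1 (1 / 4) 0 ((ω : ℕ) : ℤ) (WithLp.toLp 2 (torusCentredMomentum L qv)) : ℝ) : ℂ)) else 0 := by
  obtain ⟨hr, hδ⟩ := scaleZero_shell_params (R := R) hμ hκU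
  exact bgmGridSymbol_eq_centred_piece (by norm_num [klE0] : (0 : ℝ) < klE0) (abs_eval_le_of_frameOK hK hR) one_pos (by norm_num)
    (by linarith [Real.pi_gt_three]) hr hδ β ω q₀ qv

/-- **`hvan`, regime form** (`2¹⁵ ≤ L`): the base-band product vanishes near the zone boundary, for any factor `κf` and frequency. -/
theorem centredPiece_vanish_of_frameOK (hK : FrameOK R U Nsc μ K) (hR : ∀ j, 0 ≤ R.Gfr j) (hμ : μ ∈ klWindowC)
    (hκU : 16 / 15 * (R.Gfr 0 * |U|) ≤ 1 / 50) (hL : (2 : ℝ) ^ 15 ≤ L) (κf : EuclideanSpace ℝ (Fin 2) → ℝ) (ν : ℝ) :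
    ∀ p : Fin 2 → ℝ, (∃ l : Fin 2, Real.cos (p l) ≤ -Real.cos (4 * π / L)) →
      ((bgmCutoff₂ klE0 (fbPt ν (frameLevel μ K (WithLp.toLp 2 p))) : ℝ) : ℂ) * (((κf (WithLp.toLp 2 p)) : ℝ) : ℂ) = 0 := by
  refine centredPiece_vanish_of_cos_le (by norm_num [klE0] : (0 : ℝ) < klE0) (abs_eval_le_of_frameOK hK hR) ?_ κf ν
  obtain ⟨hμ1, hμ2⟩ := hμ
  have hLpos : (0 : ℝ) < L := lt_of_lt_of_le (by norm_num) hL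
  have h4πL : 4 * Real.pi / L ≤ 1 / 2 ^ 11 := by
    rw [div_le_iff₀ hLpos]
    have : (4 : ℝ) * Real.pi ≤ 2 ^ 4 := by linarith [Real.pi_lt_four]
    calc 4 * Real.pi ≤ 2 ^ 4 := this
      _ = 1 / 2 ^ 11 * 2 ^ 15 := by norm_num
      _ ≤ 1 / 2 ^ 11 * L := by gcongr
  have hcos : 1 - (4 * Real.pi / L) ^ 2 / 2 ≤ Real.cos (4 * Real.pi / L) := Real.one_sub_sq_div_two_le_cos
  have hsmall : (4 * Real.pi / L) ^ 2 ≤ (1 / 2 ^ 11) ^ 2 := pow_le_pow_left₀ (by positivity) h4πL 2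
  rw [klE0]
  norm_num at hsmall ⊢
  nlinarith [hcos, hsmall, hμ2, hκU]

end Regime

end Summit.HubbardSuperconductivity.HubbardSuperconductivity.Theorems.EngineV8
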